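import Mathlib
import Summits.ResolutionOfSingularities.ResolutionOfSingularities.Theorems.WeightedInvariantLocalWeightedDropTOT2CurveConflictDivTwo
import Summits.ResolutionOfSingularities.ResolutionOfSingularities.Theorems.WeightedInvariantLocalWeightedDropNCPolyBridgeExit

/-!
# `LocalWeightedDrop`, NC count game — TOT2-LINE piece S-CRV (v1.1 (D)): a KERNEL EXAMPLE of a conflict born at an on-strategy `V(y,u₂)`-move

[OURS · L1 W4.3 · chain w43, engine crux `LocalWeightedDrop` stmt-ResolutionOfSingularities-8899; piece S-CRV = res-type-088; `--supports 8899 --as helper`,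
counted 0; definition-free; nothing here is a statement of any manuscript; AI-written (gate-accepted = sorry-free with standard axioms, not refereed).]

The TOT2-LINE memo v1.1/v1.2 (D) books the conflict budget as «Σ over old stratum branches of (δ, contact orders with the N-planes) — lowered by
deviations, not raised by succT steps (CHECK the curve-centre case)» and asserts that a conflicting branch «is tangent to an N-plane only if it was
SINGULAR when that plane was created».  This file is the check of the curve-centre case, and it FAILS as booked: for the degree-2 label
`A = (u₂²(u₂ − u₁²)², 0)` (monic form `y² + u₂²(u₂ − u₁²)²`, every field):
* `A` is a position with `V(y,u₂)` permissible (`isPosT_birthExample`, `isPermissibleTwoT_birthExample`), so Σ**_d plays the `V(y,u₂)`-move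
  (`divTwoT`) and `A` is NOT a conflict state for any boundary (`not_conflict_birthExample`);
* `A` carries the SMOOTH graph branch `V(y, u₂ − u₁²)`, tangent to the centre, datum `u₁` (`graphBranch_birthExample`);
* after the move the label is `((u₂ − u₁²)², 0)` (`divTwoT_birthExample`): neither coordinate curve is permissible, the branch is still there with
  datum `u₁` — tangent to the NEW boundary plane `V(u₂)` with contact 2 — so with `u₂` a boundary letter (it is: the exceptional divisor of the move)
  the new state IS a conflict state: **`conflict_divTwoT_birthExample`**.
Hence «contact orders with N-planes» rises from 0 to 2 at a succT step and a regular branch became tangent to a plane at the plane's creation: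
the budget of (D)/(G3) must charge PAIRWISE contacts of top-locus branches (here: contact 2 of the branch with the centre), cf. the general
fact F6 `graph_divTwoT` and the design note `plan/tools/res-type-088/S-CRV-D-DESIGN.md` ADDENDUM v2/v2.1.
-/

set_option linter.dupNamespace false -- mandated namespace of this single-conjunct summit

noncomputable section

namespace Summit.ResolutionOfSingularities.ResolutionOfSingularities.Theorems

namespace TOT2Curve

open MvPowerSeries PolyDescent MonicDescent WildMonic Literature.AlgebraicGeometry.Resolution

variable {k : Type} [Field k]

/-! ## Small computations -/

/-- `u₁` is `u₂`-free. -/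
theorem X_zero_noY : ∀ e : Fin 2 →₀ ℕ, e 1 ≠ 0 → coeff e (X 0 : MvPowerSeries (Fin 2) k) = 0 := by
  intro e he
  rw [coeff_X, if_neg]
  rintro rfl
  exact he (by simp)

/-- The shear by `u₁` (`u₂ ↦ u₂ + u₁²`) straightens the branch: `(u₂ − u₁²)² ↦ u₂²`. -/
theorem shear_X_zero_branch : shear (X 0) ((X 1 - X 0 ^ 2) ^ 2 : MvPowerSeries (Fin 2) k) = X 1 ^ 2 := by
  have hs := hasSubst_of_constantCoeff_zero (constantCoeff_shearFamily (k := k) (X 0))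
  rw [shear_eq, ← coe_substAlgHom hs, map_pow, map_sub, map_pow, coe_substAlgHom, subst_X hs, subst_X hs]
  simp only [Matrix.cons_val_zero, Matrix.cons_val_one]
  ring

/-- `u₂² ∤ (u₂ − u₁²)²` (the `u₁⁴`-coefficient is `1`). -/
theorem not_X_one_sq_dvd_branch : ¬ (X 1 : MvPowerSeries (Fin 2) k) ^ 2 ∣ (X 1 - X 0 ^ 2) ^ 2 := by
  intro h
  have h0 := (X_pow_dvd_iff.mp h) (Finsupp.single 0 4) (by simp)
  have hsplit : ((X 1 - X 0 ^ 2) ^ 2 : MvPowerSeries (Fin 2) k) = X 1 * (X 1 - 2 * X 0 ^ 2) + X 0 ^ 4 := by ring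
  have h1 : coeff (Finsupp.single 0 4) (X 1 * (X 1 - 2 * X 0 ^ 2) : MvPowerSeries (Fin 2) k) = 0 :=
    (X_dvd_iff.mp (dvd_mul_right (X 1) _)) _ (by simp)
  rw [hsplit, map_add, h1, zero_add, X_pow_eq, coeff_monomial_same] at h0
  exact one_ne_zero h0

/-- `u₁² ∤ (u₂ − u₁²)²` (the `u₂²`-coefficient is `1`). -/
theorem not_X_zero_sq_dvd_branch : ¬ (X 0 : MvPowerSeries (Fin 2) k) ^ 2 ∣ (X 1 - X 0 ^ 2) ^ 2 := by
  intro h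
  have h0 := (X_pow_dvd_iff.mp h) (Finsupp.single 1 2) (by simp)
  have hsplit : ((X 1 - X 0 ^ 2) ^ 2 : MvPowerSeries (Fin 2) k) = X 0 * (X 0 ^ 3 - 2 * X 0 * X 1) + X 1 ^ 2 := by ring
  have h1 : coeff (Finsupp.single 1 2) (X 0 * (X 0 ^ 3 - 2 * X 0 * X 1) : MvPowerSeries (Fin 2) k) = 0 :=
    (X_dvd_iff.mp (dvd_mul_right (X 0) _)) _ (by simp)
  rw [hsplit, map_add, h1, zero_add, X_pow_eq, coeff_monomial_same] at h0
  exact one_ne_zero h0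

/-! ## The label before the move: a position, `V(y,u₂)` permissible, a smooth tangent graph branch, no conflict -/

/-- `A = (u₂²(u₂ − u₁²)², 0)` is a position: `ord A₀ ≥ 4 > 2`, `A₁ = 0`. -/
theorem isPosT_birthExample : IsPosT 2 (![X 1 ^ 2 * (X 1 - X 0 ^ 2) ^ 2, 0] : Fin 2 → MvPowerSeries (Fin 2) k) := by
  intro j
  fin_cases j
  · show ((2 - 0 : ℕ) : ℕ∞) < (X 1 ^ 2 * (X 1 - X 0 ^ 2) ^ 2 : MvPowerSeries (Fin 2) k).order
    have h1 : (2 : ℕ∞) ≤ (X 1 ^ 2 : MvPowerSeries (Fin 2) k).order := by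
      rw [X_pow_eq, order_monomial_of_ne_zero one_ne_zero, Finsupp.degree_single]; exact le_rfl
    have hw : (1 : ℕ∞) ≤ (X 1 - X 0 ^ 2 : MvPowerSeries (Fin 2) k).order := by
      rw [one_le_order_iff_constCoeff_eq_zero, map_sub, map_pow, constantCoeff_X, constantCoeff_X]; ring
    have h2 : (2 : ℕ∞) ≤ ((X 1 - X 0 ^ 2) ^ 2 : MvPowerSeries (Fin 2) k).order := by
      rw [pow_two]
      exact le_trans (by rw [show (2 : ℕ∞) = 1 + 1 by norm_num]; exact add_le_add hw hw) le_order_mul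
    have h4 : (4 : ℕ∞) ≤ (X 1 ^ 2 * (X 1 - X 0 ^ 2) ^ 2 : MvPowerSeries (Fin 2) k).order :=
      le_trans (by rw [show (4 : ℕ∞) = 2 + 2 by norm_num]; exact add_le_add h1 h2) le_order_mul
    exact lt_of_lt_of_le (by norm_num) h4
  · show ((2 - 1 : ℕ) : ℕ∞) < (0 : MvPowerSeries (Fin 2) k).order
    rw [order_zero]; exact WithTop.coe_lt_top _

/-- `V(y,u₂)` is permissible for `A`. -/
theorem isPermissibleTwoT_birthExample : IsPermissibleTwoT 2 (![X 1 ^ 2 * (X 1 - X 0 ^ 2) ^ 2, 0] : Fin 2 → MvPowerSeries (Fin 2) k) := by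
  rw [isPermissibleTwoT_iff_X_pow_dvd]
  intro j
  fin_cases j
  · exact dvd_mul_right _ _
  · exact dvd_zero _

/-- Hence `A` is not a conflict state, whatever the boundary: the strategy plays the `V(y,u₂)`-move. -/
theorem not_conflict_birthExample (N : Finset (Fin 2)) :
    ¬ NCPoly.Conflict 2 (![X 1 ^ 2 * (X 1 - X 0 ^ 2) ^ 2, 0] : Fin 2 → MvPowerSeries (Fin 2) k) N :=
  fun h => h.2.1 isPermissibleTwoT_birthExample

/-- The SMOOTH graph branch `V(y, u₂ − u₁²)` (datum `h = u₁`: tangent to `V(u₂)`, contact 2) is permissible for `A`. -/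
theorem graphBranch_birthExample :
    IsPermissibleTwoT 2 (shift 2 (shearT (X 0) (![X 1 ^ 2 * (X 1 - X 0 ^ 2) ^ 2, 0] : Fin 2 → MvPowerSeries (Fin 2) k)) 0) := by
  rw [shift_zero', isPermissibleTwoT_iff_X_pow_dvd]
  intro j
  fin_cases j
  · show (X 1 : MvPowerSeries (Fin 2) k) ^ (2 - 0) ∣ shear (X 0) (X 1 ^ 2 * (X 1 - X 0 ^ 2) ^ 2)
    rw [shear_mul, shear_X_zero_branch]
    exact dvd_mul_left _ _
  · show (X 1 : MvPowerSeries (Fin 2) k) ^ (2 - 1) ∣ shear (X 0) 0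
    rw [shear_eq, ← coe_substAlgHom (hasSubst_of_constantCoeff_zero (constantCoeff_shearFamily (k := k) (X 0))), map_zero]
    exact dvd_zero _

/-- So `A` has a graph curve (but succT does not use it: `V(y,u₂)` is permissible). -/
theorem hasGraphCurveT_birthExample : HasGraphCurveT 2 (![X 1 ^ 2 * (X 1 - X 0 ^ 2) ^ 2, 0] : Fin 2 → MvPowerSeries (Fin 2) k) :=
  ⟨X 0, 0, X_zero_noY, map_zero _, graphBranch_birthExample⟩

/-! ## The label after the move: a conflict state -/

/-- The `V(y,u₂)`-move: `divTwoT 2 A = ((u₂ − u₁²)², 0)`. -/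
theorem divTwoT_birthExample :
    divTwoT 2 (![X 1 ^ 2 * (X 1 - X 0 ^ 2) ^ 2, 0] : Fin 2 → MvPowerSeries (Fin 2) k) = ![(X 1 - X 0 ^ 2) ^ 2, 0] := by
  funext j
  fin_cases j
  · show divTwo (2 - 0) (X 1 ^ 2 * (X 1 - X 0 ^ 2) ^ 2 : MvPowerSeries (Fin 2) k) = (X 1 - X 0 ^ 2) ^ 2
    have hA : ∀ e : Fin 2 →₀ ℕ, coeff e (X 1 ^ 2 * (X 1 - X 0 ^ 2) ^ 2 : MvPowerSeries (Fin 2) k) ≠ 0 → 2 ≤ e 1 := by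
      intro e he
      by_contra hlt
      exact he ((X_pow_dvd_iff.mp (dvd_mul_right _ _)) e (not_le.mp hlt))
    have h := X_pow_mul_divTwo 2 _ hA
    exact mul_left_cancel₀ (pow_ne_zero 2 (X_ne_zero' 1)) h
  · show divTwo (2 - 1) (0 : MvPowerSeries (Fin 2) k) = 0
    ext e
    rw [coeff_divTwo, map_zero, map_zero]

/-- After the move `V(y,u₂)` is NOT permissible. -/
theorem not_isPermissibleTwoT_after : ¬ IsPermissibleTwoT 2 (![(X 1 - X 0 ^ 2) ^ 2, 0] : Fin 2 → MvPowerSeries (Fin 2) k) := by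
  rw [isPermissibleTwoT_iff_X_pow_dvd]
  intro h
  exact not_X_one_sq_dvd_branch (h 0)

/-- After the move `V(y,u₁)` is NOT permissible. -/
theorem not_isPermissibleOneT_after : ¬ IsPermissibleOneT 2 (![(X 1 - X 0 ^ 2) ^ 2, 0] : Fin 2 → MvPowerSeries (Fin 2) k) := by
  rw [isPermissibleOneT_iff_X_pow_dvd]
  intro h
  exact not_X_zero_sq_dvd_branch (h 0)

/-- After the move the branch is still there, with the SAME datum `u₁`: now tangent to the boundary plane `V(u₂)` with contact 2. -/
theorem graphBranch_after :
    IsPermissibleTwoT 2 (shift 2 (shearT (X 0) (![(X 1 - X 0 ^ 2) ^ 2, 0] : Fin 2 → MvPowerSeries (Fin 2) k)) 0) := by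
  rw [shift_zero', isPermissibleTwoT_iff_X_pow_dvd]
  intro j
  fin_cases j
  · show (X 1 : MvPowerSeries (Fin 2) k) ^ (2 - 0) ∣ shear (X 0) ((X 1 - X 0 ^ 2) ^ 2)
    rw [shear_X_zero_branch]
  · show (X 1 : MvPowerSeries (Fin 2) k) ^ (2 - 1) ∣ shear (X 0) 0
    rw [shear_eq, ← coe_substAlgHom (hasSubst_of_constantCoeff_zero (constantCoeff_shearFamily (k := k) (X 0))), map_zero]
    exact dvd_zero _

/-- After the move the label has a graph curve. -/
theorem hasGraphCurveT_after : HasGraphCurveT 2 (![(X 1 - X 0 ^ 2) ^ 2, 0] : Fin 2 → MvPowerSeries (Fin 2) k) :=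
  ⟨X 0, 0, X_zero_noY, map_zero _, graphBranch_after⟩

/-- **A CONFLICT IS BORN AT AN ON-STRATEGY CURVE MOVE.**  After the `V(y,u₂)`-move of succT at the non-conflict position `A = (u₂²(u₂ − u₁²)², 0)`,
with `u₂` a boundary letter (the exceptional divisor of that move), the successor `divTwoT 2 A` is a CONFLICT state of the TOT2-LINE
(`NCPoly.Conflict`): neither coordinate curve is permissible and the smooth old branch `V(y, u₂ − u₁²)` is a graph curve tangent to `V(u₂)`. -/
theorem conflict_divTwoT_birthExample (N : Finset (Fin 2)) (hN : (1 : Fin 2) ∈ N) :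
    NCPoly.Conflict 2 (divTwoT 2 (![X 1 ^ 2 * (X 1 - X 0 ^ 2) ^ 2, 0] : Fin 2 → MvPowerSeries (Fin 2) k)) N := by
  rw [divTwoT_birthExample]
  exact ⟨not_isPermissibleOneT_after, not_isPermissibleTwoT_after, hasGraphCurveT_after, hN⟩

end TOT2Curve

end Summit.ResolutionOfSingularities.ResolutionOfSingularities.Theorems

end
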